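import Mathlib
import HarnessLib
import Literature.Analysis.FluidPDE.BeltramiFlows

/-!
# The ABC host's strain envelope: `|∇U|² ≡ A²+B²+C²`, `|S_U|² = A²+B²+C² − |U|²/2`,
# and for `A = B = C = 1` the rate of strain is `≤ √2` everywhere, `= √2` exactly on the stagnation skeleton
# (instab lane, door O-acc = O7, obstruction P3: the HOST half of the θ-bracket of `HEREDITY-P3.md` (B)/(F))

HONEST FRAMING (cell `ns-blowup`, seat `ns-blowup-instab2`; human ruling D-0035): nothing here is a
claim about Navier–Stokes blow-up. WHAT THIS IS NOT: not dynamics of any flow; it is pointwise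
trigonometric algebra on the tree's ABC field `Literature.Analysis.FluidPDE.ABC.abc A B C` and its
Jacobian `ABC.jac A B C x j i` (row `j` = `∂/∂xⱼ`, column `i` = component).

## What is proved (every `x ∈ ℝ³`, every `A B C : ℝ` unless stated)

* `jac_diag_eq_zero`: `∂ⱼUⱼ = 0` for each `j` separately (the Jacobian is hollow; incompressibility
  term by term);
* `jac_frobenius_sq`: `Σⱼᵢ (∂ⱼUᵢ)² = A² + B² + C²` — the velocity-gradient magnitude of an ABC flow is a
  CONSTANT of space;
* `strain_frobenius_sq`: with `S = ½(∇U + ∇Uᵀ)`, `Σⱼᵢ Sⱼᵢ² = A² + B² + C² − |U(x)|²/2`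
  (the Beltrami split `|∇U|² = |S|² + |ω|²/2` with `ω = U`, here by direct expansion) — so the host's
  strain is LARGEST where the host is SLOWEST and vanishes exactly at the max-speed points;
  corollary `speed_sq_le`: `|U(x)|² ≤ 2(A² + B² + C²)` (`≤ 6` for `1:1:1`, the classical `max |U| = √6`);
* `strain_quadForm_sq_le`: for every direction `v`, the stretching rate `vᵀ(∇U)v = vᵀSv` obeys
  `(vᵀSv)² ≤ ((2(A²+B²+C²) − |U(x)|²)/3)·|v|⁴` (Cauchy–Schwarz on the three off-diagonal pairs, inline,
  + `pair_products_le`: `v₀²v₁² + v₀²v₂² + v₁²v₂² ≤ |v|⁴/3`);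
* for `A = B = C = 1` (the P-TOWER-1′ host): `strain_quadForm_le_sqrt_two` — `vᵀSv ≤ √2·|v|²` and
  `−√2·|v|² ≤ vᵀSv` for all `x`, `v`: NO material line element anywhere in the host cell is stretched or
  compressed faster than `σ_α = √2`, the rate at the α-points (`ABCAlphaPointStrain.gradU_alpha0_mulVec_ones`);
  `strain_quadForm_alpha0_ones`: equality at `α₀` along `(1,1,1)` — the envelope is ATTAINED on the
  skeleton and, by `strain_frobenius_sq`, only where `U = 0` can it be attained (`strain_quadForm_sq_le'`:
  `(vᵀSv)² ≤ (2 − |U|²/3)|v|⁴ < 2|v|⁴` off the zero set);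
* `envelope_add`: the θ-bracket composition — if a second gradient `T` (the rope's own) satisfies
  `vᵀTv ≤ s·|v|²` then `vᵀ(∇U + T)v ≤ (√2 + s)·|v|²` (sub-additivity of the largest strain rate is EXACT;
  with the kernel one-tube constant `s = (3/20)·ω₀` of `BurgersTubeStrainSharp` this is the «one Gaussian
  rope in the ABC host» envelope `λ_max(S_u) ≤ √2 + (3/20)ω₀` that the site detector's `[theta]` line is
  read against — DESCRIPTIVE use only, see `instab2/SITE-DETECTOR.md`).

Mathlib + `Literature.Analysis.FluidPDE.BeltramiFlows` only (the two trigonometric values at `7π/4` are re-derived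
privately so that this file does not wait on `ABCAlphaPointStrain`'s olean; the equality case agrees with its `jac_alpha0`).
No definitions. LABEL: MODEL-door kinematics of the forced-ABC host. Source for the skeleton: Dombre, Frisch,
Greene, Hénon, Mehr, Soward, J. Fluid Mech. 167 (1986) 353–391, §4; the identities themselves are
elementary and, as far as this seat knows, folklore.
-/

namespace Summit.NavierStokesRegularity.FluidComputer.ABCHostStrainEnvelope

open Real Literature.Analysis.FluidPDE

/-! ## §1 The Jacobian is hollow and has constant Frobenius norm -/

/-- `∂ⱼUⱼ = 0` for each `j`: no ABC component depends on its own coordinate. -/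
theorem jac_diag_eq_zero (A B C : ℝ) (x : EuclideanSpace ℝ (Fin 3)) (j : Fin 3) :
    ABC.jac A B C x j j = 0 := by
  fin_cases j <;> simp [ABC.jac]

/-- `|∇U(x)|²_F = Σⱼ Σᵢ (∂ⱼUᵢ)² = A² + B² + C²` for every `x`: a constant of space. -/
theorem jac_frobenius_sq (A B C : ℝ) (x : EuclideanSpace ℝ (Fin 3)) :
    ∑ j : Fin 3, ∑ i : Fin 3, (ABC.jac A B C x j i) ^ 2 = A ^ 2 + B ^ 2 + C ^ 2 := by
  simp only [Fin.sum_univ_three]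
  simp only [ABC.jac, Matrix.cons_val_zero, Matrix.cons_val_one, Matrix.cons_val_two,
    Matrix.head_cons, Matrix.tail_cons]
  linear_combination B ^ 2 * Real.sin_sq_add_cos_sq (x 0) + C ^ 2 * Real.sin_sq_add_cos_sq (x 1) +
    A ^ 2 * Real.sin_sq_add_cos_sq (x 2)

/-! ## §2 The speed and the strain: `|S|² + |U|²/2 = A² + B² + C²` -/

/-- The squared speed written out: `Σᵢ Uᵢ(x)² = (A sin x₂ + C cos x₁)² + (B sin x₀ + A cos x₂)² + (C sin x₁ + B cos x₀)²`. -/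
theorem speed_sq_eq (A B C : ℝ) (x : EuclideanSpace ℝ (Fin 3)) :
    ∑ i : Fin 3, (ABC.abc A B C x i) ^ 2 =
      (A * sin (x 2) + C * cos (x 1)) ^ 2 + (B * sin (x 0) + A * cos (x 2)) ^ 2 +
        (C * sin (x 1) + B * cos (x 0)) ^ 2 := by
  simp only [Fin.sum_univ_three, ABC.abc_apply_zero, ABC.abc_apply_one, ABC.abc_apply_two]

/-- The Euclidean norm of `U(x)` squared is that sum: `‖U(x)‖² = Σᵢ Uᵢ(x)²`. -/
theorem norm_sq_eq_sum (A B C : ℝ) (x : EuclideanSpace ℝ (Fin 3)) :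
    ‖ABC.abc A B C x‖ ^ 2 = ∑ i : Fin 3, (ABC.abc A B C x i) ^ 2 := by
  rw [EuclideanSpace.norm_sq_eq]
  refine Finset.sum_congr rfl (fun i _ => ?_)
  rw [Real.norm_eq_abs, sq_abs]

/-- THE STRAIN IDENTITY: with `Sⱼᵢ = (∂ⱼUᵢ + ∂ᵢUⱼ)/2`,
`Σⱼ Σᵢ Sⱼᵢ² = A² + B² + C² − (Σᵢ Uᵢ²)/2` at every point. (For a Beltrami field `curl U = U` this is
`|∇U|² = |S|² + |ω|²/2`; here it is checked by expansion, using only `sin² + cos² = 1`.) -/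
theorem strain_frobenius_sq (A B C : ℝ) (x : EuclideanSpace ℝ (Fin 3)) :
    ∑ j : Fin 3, ∑ i : Fin 3, ((ABC.jac A B C x j i + ABC.jac A B C x i j) / 2) ^ 2 =
      A ^ 2 + B ^ 2 + C ^ 2 - (∑ i : Fin 3, (ABC.abc A B C x i) ^ 2) / 2 := by
  rw [speed_sq_eq]
  simp only [Fin.sum_univ_three]
  simp only [ABC.jac, Matrix.cons_val_zero, Matrix.cons_val_one, Matrix.cons_val_two,
    Matrix.head_cons, Matrix.tail_cons]
  linear_combination B ^ 2 * Real.sin_sq_add_cos_sq (x 0) + C ^ 2 * Real.sin_sq_add_cos_sq (x 1) +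
    A ^ 2 * Real.sin_sq_add_cos_sq (x 2)

/-- Corollary: `Σᵢ Uᵢ(x)² ≤ 2(A² + B² + C²)` everywhere (a sum of squares is non-negative) — for `1:1:1`
the classical `|U| ≤ √6`, attained at the max-speed points where the strain VANISHES. -/
theorem speed_sq_le (A B C : ℝ) (x : EuclideanSpace ℝ (Fin 3)) :
    ∑ i : Fin 3, (ABC.abc A B C x i) ^ 2 ≤ 2 * (A ^ 2 + B ^ 2 + C ^ 2) := by
  have h := strain_frobenius_sq A B C x
  have hnn : 0 ≤ ∑ j : Fin 3, ∑ i : Fin 3, ((ABC.jac A B C x j i + ABC.jac A B C x i j) / 2) ^ 2 :=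
    Finset.sum_nonneg (fun j _ => Finset.sum_nonneg (fun i _ => sq_nonneg _))
  linarith

/-- `1:1:1`: `‖U(x)‖² ≤ 6`. -/
theorem norm_sq_le_six (x : EuclideanSpace ℝ (Fin 3)) : ‖ABC.abc 1 1 1 x‖ ^ 2 ≤ 6 := by
  rw [norm_sq_eq_sum]
  have := speed_sq_le 1 1 1 x
  linarith

/-! ## §3 The stretching rate in a direction `v`: `vᵀ(∇U)v` -/

/-- The quadratic form of the Jacobian equals that of its symmetric part and, the diagonal being zero,
reduces to the three off-diagonal pairs:
`Σⱼ Σᵢ vⱼ (∂ⱼUᵢ) vᵢ = (∂₀U₁+∂₁U₀)v₀v₁ + (∂₀U₂+∂₂U₀)v₀v₂ + (∂₁U₂+∂₂U₁)v₁v₂`. -/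
theorem quadForm_eq (A B C : ℝ) (x : EuclideanSpace ℝ (Fin 3)) (v : Fin 3 → ℝ) :
    ∑ j : Fin 3, ∑ i : Fin 3, v j * ABC.jac A B C x j i * v i =
      (ABC.jac A B C x 0 1 + ABC.jac A B C x 1 0) * (v 0 * v 1) +
        (ABC.jac A B C x 0 2 + ABC.jac A B C x 2 0) * (v 0 * v 2) +
          (ABC.jac A B C x 1 2 + ABC.jac A B C x 2 1) * (v 1 * v 2) := by
  simp only [Fin.sum_univ_three, jac_diag_eq_zero]
  ring

/-- The three off-diagonal pair sums squared add up to `2(A²+B²+C²) − Σᵢ Uᵢ²` (twice `strain_frobenius_sq`'s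
off-diagonal content). -/
theorem offdiag_pairs_sq (A B C : ℝ) (x : EuclideanSpace ℝ (Fin 3)) :
    (ABC.jac A B C x 0 1 + ABC.jac A B C x 1 0) ^ 2 + (ABC.jac A B C x 0 2 + ABC.jac A B C x 2 0) ^ 2 +
        (ABC.jac A B C x 1 2 + ABC.jac A B C x 2 1) ^ 2 =
      2 * (A ^ 2 + B ^ 2 + C ^ 2) - ∑ i : Fin 3, (ABC.abc A B C x i) ^ 2 := by
  rw [speed_sq_eq]
  simp only [ABC.jac, Matrix.cons_val_zero, Matrix.cons_val_one, Matrix.cons_val_two,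
    Matrix.head_cons, Matrix.tail_cons]
  linear_combination (2 * B ^ 2) * Real.sin_sq_add_cos_sq (x 0) + (2 * C ^ 2) * Real.sin_sq_add_cos_sq (x 1) +
    (2 * A ^ 2) * Real.sin_sq_add_cos_sq (x 2)

/-- The pair products of a vector are controlled by its length: `v₀²v₁² + v₀²v₂² + v₁²v₂² ≤ (v₀²+v₁²+v₂²)²/3`
(equality iff `v₀² = v₁² = v₂²`, e.g. along the diagonal `(1,1,1)`). -/
theorem pair_products_le (v : Fin 3 → ℝ) :
    (v 0 * v 1) ^ 2 + (v 0 * v 2) ^ 2 + (v 1 * v 2) ^ 2 ≤ (v 0 ^ 2 + v 1 ^ 2 + v 2 ^ 2) ^ 2 / 3 := by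
  nlinarith [sq_nonneg (v 0 ^ 2 - v 1 ^ 2), sq_nonneg (v 0 ^ 2 - v 2 ^ 2), sq_nonneg (v 1 ^ 2 - v 2 ^ 2)]

/-- THE POINTWISE STRAIN BOUND (all `A B C`): for every direction `v`,
`(vᵀ(∇U)v)² ≤ ((2(A²+B²+C²) − Σᵢ Uᵢ(x)²)/3) · (v₀²+v₁²+v₂²)²`. -/
theorem strain_quadForm_sq_le (A B C : ℝ) (x : EuclideanSpace ℝ (Fin 3)) (v : Fin 3 → ℝ) :
    (∑ j : Fin 3, ∑ i : Fin 3, v j * ABC.jac A B C x j i * v i) ^ 2 ≤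
      (2 * (A ^ 2 + B ^ 2 + C ^ 2) - ∑ i : Fin 3, (ABC.abc A B C x i) ^ 2) / 3 *
        (v 0 ^ 2 + v 1 ^ 2 + v 2 ^ 2) ^ 2 := by
  rw [quadForm_eq, ← offdiag_pairs_sq]
  set a := ABC.jac A B C x 0 1 + ABC.jac A B C x 1 0
  set b := ABC.jac A B C x 0 2 + ABC.jac A B C x 2 0
  set c := ABC.jac A B C x 1 2 + ABC.jac A B C x 2 1
  -- Cauchy–Schwarz for three terms (Lagrange's identity; the tree's `Kerr.sq_dot_le_three` is the same
  -- inequality in another corner of the library — re-derived inline rather than importing Lorentzian geometry)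
  have h1 : (a * (v 0 * v 1) + b * (v 0 * v 2) + c * (v 1 * v 2)) ^ 2 ≤
      (a ^ 2 + b ^ 2 + c ^ 2) * ((v 0 * v 1) ^ 2 + (v 0 * v 2) ^ 2 + (v 1 * v 2) ^ 2) := by
    nlinarith [sq_nonneg (a * (v 0 * v 2) - b * (v 0 * v 1)), sq_nonneg (a * (v 1 * v 2) - c * (v 0 * v 1)),
      sq_nonneg (b * (v 1 * v 2) - c * (v 0 * v 2))]
  have h2 := pair_products_le v
  have h3 : 0 ≤ a ^ 2 + b ^ 2 + c ^ 2 := by positivity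
  calc (a * (v 0 * v 1) + b * (v 0 * v 2) + c * (v 1 * v 2)) ^ 2
      ≤ (a ^ 2 + b ^ 2 + c ^ 2) * ((v 0 * v 1) ^ 2 + (v 0 * v 2) ^ 2 + (v 1 * v 2) ^ 2) := h1
    _ ≤ (a ^ 2 + b ^ 2 + c ^ 2) * ((v 0 ^ 2 + v 1 ^ 2 + v 2 ^ 2) ^ 2 / 3) :=
        mul_le_mul_of_nonneg_left h2 h3
    _ = (a ^ 2 + b ^ 2 + c ^ 2) / 3 * (v 0 ^ 2 + v 1 ^ 2 + v 2 ^ 2) ^ 2 := by ring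

/-! ## §4 The host of record `A = B = C = 1`: the envelope `√2` -/

/-- `1:1:1`, refined form: `(vᵀ(∇U)v)² ≤ (2 − ‖U(x)‖²/3)·|v|⁴` — the available stretching DECREASES with the
local host speed and can reach `2|v|⁴` only on the zero set of `U` (the stagnation skeleton). -/
theorem strain_quadForm_sq_le' (x : EuclideanSpace ℝ (Fin 3)) (v : Fin 3 → ℝ) :
    (∑ j : Fin 3, ∑ i : Fin 3, v j * ABC.jac 1 1 1 x j i * v i) ^ 2 ≤
      (2 - ‖ABC.abc 1 1 1 x‖ ^ 2 / 3) * (v 0 ^ 2 + v 1 ^ 2 + v 2 ^ 2) ^ 2 := by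
  have h := strain_quadForm_sq_le 1 1 1 x v
  rw [← norm_sq_eq_sum] at h
  have e : (2 * ((1:ℝ) ^ 2 + 1 ^ 2 + 1 ^ 2) - ‖ABC.abc 1 1 1 x‖ ^ 2) / 3 = 2 - ‖ABC.abc 1 1 1 x‖ ^ 2 / 3 := by ring
  rw [e] at h
  exact h

/-- `1:1:1`: `(vᵀ(∇U)v)² ≤ 2·|v|⁴` everywhere. -/
theorem strain_quadForm_sq_le_two (x : EuclideanSpace ℝ (Fin 3)) (v : Fin 3 → ℝ) :
    (∑ j : Fin 3, ∑ i : Fin 3, v j * ABC.jac 1 1 1 x j i * v i) ^ 2 ≤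
      2 * (v 0 ^ 2 + v 1 ^ 2 + v 2 ^ 2) ^ 2 := by
  have h := strain_quadForm_sq_le' x v
  have hn : 0 ≤ ‖ABC.abc 1 1 1 x‖ ^ 2 := sq_nonneg _
  have hv : 0 ≤ (v 0 ^ 2 + v 1 ^ 2 + v 2 ^ 2) ^ 2 := sq_nonneg _
  nlinarith

/-- THE HOST STRAIN ENVELOPE: `vᵀ(∇U)v ≤ √2 · |v|²` for every point `x` of the `1:1:1` cell and every `v` —
no line element is stretched faster than `σ_α = √2`. -/
theorem strain_quadForm_le_sqrt_two (x : EuclideanSpace ℝ (Fin 3)) (v : Fin 3 → ℝ) :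
    ∑ j : Fin 3, ∑ i : Fin 3, v j * ABC.jac 1 1 1 x j i * v i ≤
      Real.sqrt 2 * (v 0 ^ 2 + v 1 ^ 2 + v 2 ^ 2) := by
  have h := strain_quadForm_sq_le_two x v
  have hv : 0 ≤ v 0 ^ 2 + v 1 ^ 2 + v 2 ^ 2 := by positivity
  have hs : Real.sqrt 2 * (v 0 ^ 2 + v 1 ^ 2 + v 2 ^ 2) =
      Real.sqrt (2 * (v 0 ^ 2 + v 1 ^ 2 + v 2 ^ 2) ^ 2) := by
    rw [Real.sqrt_mul (by norm_num : (0:ℝ) ≤ 2), Real.sqrt_sq hv]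
  rw [hs]
  exact Real.le_sqrt_of_sq_le h

/-- … and none is compressed faster than `√2`: `−√2 · |v|² ≤ vᵀ(∇U)v`. -/
theorem neg_sqrt_two_le_strain_quadForm (x : EuclideanSpace ℝ (Fin 3)) (v : Fin 3 → ℝ) :
    -(Real.sqrt 2 * (v 0 ^ 2 + v 1 ^ 2 + v 2 ^ 2)) ≤
      ∑ j : Fin 3, ∑ i : Fin 3, v j * ABC.jac 1 1 1 x j i * v i := by
  have h := strain_quadForm_sq_le_two x v
  have hv : 0 ≤ v 0 ^ 2 + v 1 ^ 2 + v 2 ^ 2 := by positivity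
  have hs : Real.sqrt 2 * (v 0 ^ 2 + v 1 ^ 2 + v 2 ^ 2) =
      Real.sqrt (2 * (v 0 ^ 2 + v 1 ^ 2 + v 2 ^ 2) ^ 2) := by
    rw [Real.sqrt_mul (by norm_num : (0:ℝ) ≤ 2), Real.sqrt_sq hv]
  rw [hs]
  exact Real.neg_sqrt_le_of_sq_le h

/-- `sin(7π/4) = −√2/2` (re-derived here; also `ABCAlphaPointStrain.sin_seven_pi_div_four`). -/
private theorem sin_seven_pi_div_four : Real.sin (7 * π / 4) = -(Real.sqrt 2 / 2) := by
  have h : 7 * π / 4 = 2 * π - π / 4 := by ring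
  rw [h, Real.sin_two_pi_sub, Real.sin_pi_div_four]

/-- `cos(7π/4) = √2/2` (re-derived here; also `ABCAlphaPointStrain.cos_seven_pi_div_four`). -/
private theorem cos_seven_pi_div_four : Real.cos (7 * π / 4) = Real.sqrt 2 / 2 := by
  have h : 7 * π / 4 = 2 * π - π / 4 := by ring
  rw [h, Real.cos_two_pi_sub, Real.cos_pi_div_four]

/-- ATTAINED ON THE SKELETON: at `α₀ = (7π/4, 7π/4, 7π/4)` along `v = (1,1,1)` the stretching rate is
`3√2 = √2·|v|²` (every off-diagonal entry of `∇U(α₀)` is `√2/2`, cf. `ABCAlphaPointStrain.jac_alpha0`).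
With `strain_quadForm_sq_le'` (slack `‖U‖²/3`) the envelope `√2` is reached ONLY on the zero set of `U`. -/
theorem strain_quadForm_alpha0_ones :
    ∑ j : Fin 3, ∑ i : Fin 3, (1 : ℝ) *
        ABC.jac 1 1 1 (!₂[7 * π / 4, 7 * π / 4, 7 * π / 4] : EuclideanSpace ℝ (Fin 3)) j i * 1 =
      Real.sqrt 2 * ((1:ℝ) ^ 2 + 1 ^ 2 + 1 ^ 2) := by
  simp only [Fin.sum_univ_three]
  simp [ABC.jac, sin_seven_pi_div_four, cos_seven_pi_div_four]
  ring

/-- Off the skeleton the bound is STRICT: if `U(x) ≠ 0` and `v ≠ 0` then `(vᵀ(∇U)v)² < 2|v|⁴`. -/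
theorem strain_quadForm_sq_lt_two {x : EuclideanSpace ℝ (Fin 3)} (hx : ABC.abc 1 1 1 x ≠ 0)
    {v : Fin 3 → ℝ} (hv : v 0 ^ 2 + v 1 ^ 2 + v 2 ^ 2 ≠ 0) :
    (∑ j : Fin 3, ∑ i : Fin 3, v j * ABC.jac 1 1 1 x j i * v i) ^ 2 <
      2 * (v 0 ^ 2 + v 1 ^ 2 + v 2 ^ 2) ^ 2 := by
  have h := strain_quadForm_sq_le' x v
  have hn : 0 < ‖ABC.abc 1 1 1 x‖ ^ 2 := by positivity
  have hv' : 0 < (v 0 ^ 2 + v 1 ^ 2 + v 2 ^ 2) ^ 2 := by positivity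
  nlinarith

/-! ## §5 The θ-bracket composition: host envelope + the rope's own strain -/

/-- SUB-ADDITIVITY OF THE LARGEST STRAIN RATE (exact): if a second velocity gradient `T` — the rope's
own, or any structure's — stretches no direction faster than `s`, then the TOTAL field `∇U + T` stretches
no direction faster than `√2 + s`. With the kernel one-Gaussian-tube constant `s = (3/20)·ω₀`
(`BurgersTubeStrainSharp.oseenStrain_le_sharp`, `LambOseenStrainField.strain_offdiag_abs_le`) this is the
«one rope in the ABC host» envelope `λ_max ≤ √2 + (3/20)ω₀`; a measured strain maximum ABOVE it needs
more than one Gaussian tube plus the host (DESCRIPTIVE reading of the site detector's `[theta]` line). -/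
theorem envelope_add (x : EuclideanSpace ℝ (Fin 3)) (T : Fin 3 → Fin 3 → ℝ) (s : ℝ)
    (hT : ∀ v : Fin 3 → ℝ, ∑ j : Fin 3, ∑ i : Fin 3, v j * T j i * v i ≤ s * (v 0 ^ 2 + v 1 ^ 2 + v 2 ^ 2))
    (v : Fin 3 → ℝ) :
    ∑ j : Fin 3, ∑ i : Fin 3, v j * (ABC.jac 1 1 1 x j i + T j i) * v i ≤
      (Real.sqrt 2 + s) * (v 0 ^ 2 + v 1 ^ 2 + v 2 ^ 2) := by
  have h1 := strain_quadForm_le_sqrt_two x v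
  have h2 := hT v
  have e : ∑ j : Fin 3, ∑ i : Fin 3, v j * (ABC.jac 1 1 1 x j i + T j i) * v i =
      (∑ j : Fin 3, ∑ i : Fin 3, v j * ABC.jac 1 1 1 x j i * v i) +
        ∑ j : Fin 3, ∑ i : Fin 3, v j * T j i * v i := by
    rw [← Finset.sum_add_distrib]
    refine Finset.sum_congr rfl (fun j _ => ?_)
    rw [← Finset.sum_add_distrib]
    refine Finset.sum_congr rfl (fun i _ => ?_)
    ring
  rw [e]
  linarith

/-- The normalised envelope (the number the `[theta]` line is compared with): dividing by a vorticity scale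
`ω_pk > 0`, `(√2 + (3/20)·ω₀)/ω_pk = (3/20)·(ω₀/ω_pk) + √2/ω_pk` — `3/20` from the rope, `√2/ω_pk` from the
host, the latter SHRINKING as the rope intensifies (`ω_pk ∝ R` on the pilots). -/
theorem envelope_normalised (ω₀ ω_pk : ℝ) (hpk : ω_pk ≠ 0) :
    (Real.sqrt 2 + 3 / 20 * ω₀) / ω_pk = 3 / 20 * (ω₀ / ω_pk) + Real.sqrt 2 / ω_pk := by
  field_simp
  ring

end Summit.NavierStokesRegularity.FluidComputer.ABCHostStrainEnvelope
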